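import Mathlib
import Summits.ValiantsHypothesis.ValiantsHypothesis.Theorems.LacunarySymmetroidMatrixDescartesCensusDefs
import Summits.ValiantsHypothesis.ValiantsHypothesis.Theorems.LacunarySymmetroidMatrixDescartesCensusBox20Reduce

/-!
# Tower graft line — EXPONENT HALVING COSTS SIZE TRIPLING: the letter axis embeds into the size axis

Mechanism / calibration file for LINE (B) `Cruxes/WeakLifting/Lines/tower_graft.lean` of the crux `WeakLifting`
(stmt-ValiantsHypothesis-19561); it relates the currencies of the line's two research stubs — S5 `TowerGraftLaw` (ONE MORE
LETTER at a far level, same size) and S4d `TowerSizeDoubling` (SAME support, bigger size) — by an exact determinant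
identity.  NO stub is claimed.

THE IDENTITY (§1, any commutative ring, `det_borderThree_eq`).  For square `G`, `L` of the same size and a scalar `x`,
`det [[G, x·1, 0], [x·1, 0, 1], [0, 1, L]] = det [[0,1],[1,L]] · det (G + x²·L)`: the corner `N = [[0,1],[1,L]]` is
invertible for EVERY `L` (inverse `[[−L,1],[1,0]]`, `borderThree_mul_inv`), its inverse has `(1,1)` block `−L`, and the
Schur complement of `N` is `G + x²·L` (Mathlib `det_fromBlocks₂₂`).  No factorisation of `L` (rank, signature) is used;
the rank-refined Gram form `det [[G, x·U],[x·Uᵀ, −W]] = det(−W)·det(G + x²·UWUᵀ)` (`W² = 1`) is `det_borderGram_eq`.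

THE EXCHANGE (§2, `PosRootLawOn` currency of `…CensusDefs`).  Take `G = ∑ₗ X^{dₗ} Sₗ` symmetric of size `m` on a support `d`
containing the level `0`, a far letter `L` at level `2b` and `x = X^b`: the bordered matrix is a SYMMETRIC lacunary pencil
of size `3m` on `(d, b)` — letters `Sₗ ⊕ 0 ⊕ 0` at level `dₗ`, the constant corner `0 ⊕ [[0,1],[1,L]]` merged into the
level-`0` letter, and the off-diagonal pair `[[0,1,0],[1,0,0],[0,0,0]]` at the HALVED level `b` (`borderThree_pencil_eq`) —
with the same positive roots.  Hence
* `posRootLawOn_snoc_double`: `PosRootLawOn (3m) (K+1) B (d, b) → PosRootLawOn m (K+1) B (d, 2b)` — ONE HALVING OF THE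
  FAR LEVEL COSTS ONE TRIPLING OF THE SIZE, `ζ₊(m; d, 2b) ≤ ζ₊(3m; d, b)`;
* `posRootLawOn_snoc_dyadic` ★: `PosRootLawOn (3ⁿ·m) K B d → PosRootLawOn m (K+1) B (d, 2ⁿ·dₗ)` for every letter index
  `l` — A FAR LETTER AT A DYADIC MULTIPLE OF AN EXISTING LEVEL IS ABSORBED BY THE `K`-LETTER CLASS AT SIZE `3ⁿ·m`
  (`n` halvings, then the far letter merges into the letter `l`, `posRootLawOn_snoc_self`); `…_shift`: arbitrary minimum
  level (`Census.posRootLawOn_add_const_iff`); `not_posRootLawOn_of_snoc_dyadic`: the contrapositive for the lower-bound table.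
Every rank and signature of the far letter, every `B`, no tower hypothesis, no additive term.

READING FOR THE LINE (honest).  (1) S5 restricted to dyadic far levels `D = 2ⁿ·dₗ` FOLLOWS from any size-MULTIPLICATION
class law `ζ₊(3ⁿ·m; d) ≤ F · ζ₊(m; d) + A` with the same constants; at the tower threshold `D > m·d_{K−1}` one needs
`2ⁿ > m`, i.e. size `≥ m^{1+log₂3}`.  (2) This does NOT discharge S5 from S4d: S4d is guarded by `IsTower (size) d`, which
fails long before size `m²` (it needs `size · dₗ < dₗ₊₁`), and `n ≈ log₂ m` triplings at factor `2^C` each would give a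
multiplicative `m^{O(C)}`, not S5's `2^C·B + 2^{C·log₂²m}`.  (3) What it does give: an exact, hypothesis-free conversion
of far-letter questions into fixed-support questions (and of `(K+1)`-letter lower bounds into `K`-letter lower bounds at
larger size), and the statement that the LETTER axis of the line is a sub-axis of the SIZE axis up to dyadic rounding of
the far level.  Rank refinement (not typed here): factoring `L = U·diag(±1)·Uᵀ` with `U` of width `r = rank L` borders by
`r` instead of `2m` rows (`size m + r` per halving, `m + (2ⁿ−1)·r` after `n`), e.g. `2m+1`-type sizes for the corner graft.

HONEST FRAMING: exact identities and their budget-relative reading; nothing on S4/S4b/S4d/S4f/S5/S5ᴸ, TowerB, `WeakLifting`,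
Conjecture B, 18050 or VP ≠ VNP; zero crux credit.  Def-free; Mathlib + two census files.  Seat: prover val-sym-lift-p2 g21
(`prover-val-sym-lift-p2-g21-0`), `--supports stmt-ValiantsHypothesis-19561 --as helper`.
-/

-- `Summit.ValiantsHypothesis.ValiantsHypothesis.…` repeats a component by the D-0017 layout
-- (single-conjunct summit), which the `dupNamespace` linter flags; the name is mandated.
set_option linter.dupNamespace false

namespace Summit.ValiantsHypothesis.ValiantsHypothesis.Theorems.KPlusLogSqLaw.TowerGraft

open Finset Polynomial Matrix
open scoped BigOperators Polynomial
open Summit.ValiantsHypothesis.ValiantsHypothesis.Theorems.LacunarySymmetroidMatrixDescartes (PosRootLawOn)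

/-! ## §1 The three-block bordering identity over a commutative ring -/

section Border

variable {ι : Type*} [Fintype ι] [DecidableEq ι] {R : Type*} [CommRing R]

/-- the bordering block `[[0, 1], [1, L]]` has the explicit inverse `[[-L, 1], [1, 0]]`. [folklore] -/
theorem borderThree_mul_inv (L : Matrix ι ι R) :
    fromBlocks (0 : Matrix ι ι R) 1 1 L * fromBlocks (-L) 1 1 0 = 1 := by
  rw [fromBlocks_multiply]
  simp [fromBlocks_one]

/-- hence its determinant is a unit. [folklore] -/
theorem det_borderThree_mul (L : Matrix ι ι R) :
    (fromBlocks (0 : Matrix ι ι R) 1 1 L).det * (fromBlocks (-L) 1 1 (0 : Matrix ι ι R)).det = 1 := by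
  rw [← det_mul, borderThree_mul_inv, det_one]

/-- **THE THREE-BLOCK BORDERING IDENTITY.**  For square `G`, `L` and a scalar `x`,
`det [[G, x·1, 0], [x·1, 0, 1], [0, 1, L]] = det [[0,1],[1,L]] · det (G + x²·L)`
(Schur complement of the invertible corner `[[0,1],[1,L]]`, whose inverse has `(1,1)` block `-L`). [folklore] -/
theorem det_borderThree_eq (G L : Matrix ι ι R) (x : R) :
    (fromBlocks G (fromCols (x • (1 : Matrix ι ι R)) 0) (fromRows (x • (1 : Matrix ι ι R)) 0)
        (fromBlocks (0 : Matrix ι ι R) 1 1 L)).det =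
      (fromBlocks (0 : Matrix ι ι R) 1 1 L).det * (G + (x * x) • L).det := by
  haveI := invertibleOfRightInverse _ _ (borderThree_mul_inv L)
  rw [det_fromBlocks₂₂, invOf_eq_right_inv (borderThree_mul_inv L), fromCols_mul_fromBlocks,
    fromCols_mul_fromRows]
  congr 2
  simp only [add_zero, Matrix.mul_one, smul_mul_assoc, Matrix.one_mul, Matrix.mul_zero,
    Matrix.mul_smul, Matrix.mul_neg, smul_neg, smul_smul, smul_zero, sub_neg_eq_add]

/-- **Rank-refined bordering (Gram form).**  For `U : ι × κ` and a symmetric involution `W` (`W·W = 1`: signs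
`diag(±1)` — Sylvester — or the pairing `[[0,1],[1,0]]`), `det [[G, x·U], [x·Uᵀ, −W]] = det(−W) · det (G + x²·U W Uᵀ)`:
a far letter `U W Uᵀ` of rank `≤ |κ|` is the Schur complement of a bordering by only `|κ|` rows, the new far letter
`[[0,U],[Uᵀ,0]] = U′·[[0,1],[1,0]]·U′ᵀ` (`U′ = U ⊕ 1`) being again of this form with `|κ|` doubled. [folklore] -/
theorem det_borderGram_eq {κ : Type*} [Fintype κ] [DecidableEq κ] (G : Matrix ι ι R) (U : Matrix ι κ R)
    (W : Matrix κ κ R) (hW : W * W = 1) (x : R) :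
    (fromBlocks G (x • U) (x • Uᵀ) (-W)).det = (-W).det * (G + (x * x) • (U * W * Uᵀ)).det := by
  have hW' : (-W) * (-W) = 1 := by rw [neg_mul_neg, hW]
  haveI := invertibleOfRightInverse _ _ hW'
  rw [det_fromBlocks₂₂, invOf_eq_right_inv hW']
  congr 2
  simp only [Matrix.smul_mul, Matrix.mul_smul, Matrix.mul_neg, Matrix.neg_mul, smul_neg, sub_neg_eq_add, smul_smul]

end Border

/-! ## §2 Exponent halving costs size tripling; dyadic far letters are absorbed by the `K`-letter class -/

section Halving

variable {m K B : ℕ}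

/-- merging a far letter that sits AT an existing level `d l` into the letter `l`: the `(K+1)`-letter class on
`(d, d l)` is the `K`-letter class on `d`. [folklore] -/
theorem posRootLawOn_snoc_self (d : Fin K → ℕ) (l : Fin K) (h : PosRootLawOn m K B d) :
    PosRootLawOn m (K + 1) B (Fin.snoc d (d l)) := by
  intro S hS
  have key : (∑ l', (X : ℝ[X]) ^ (Fin.snoc d (d l) : Fin (K + 1) → ℕ) l' • (S l').map C) =
      ∑ l', (X : ℝ[X]) ^ d l' • (S (Fin.castSucc l') + if l' = l then S (Fin.last K) else 0).map C := by
    rw [Fin.sum_univ_castSucc]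
    simp only [Fin.snoc_castSucc, Fin.snoc_last]
    have hmap : ∀ l', ((S (Fin.castSucc l') + if l' = l then S (Fin.last K) else 0).map C) =
        (S (Fin.castSucc l')).map C + if l' = l then (S (Fin.last K)).map C else 0 := by
      intro l'
      split_ifs
      · exact Matrix.ext fun i j => by simp only [Matrix.map_apply, Matrix.add_apply, map_add]
      · rw [add_zero, add_zero]
    simp_rw [hmap, smul_add, Finset.sum_add_distrib, smul_ite, smul_zero, Finset.sum_ite_eq' Finset.univ l,
      if_pos (Finset.mem_univ l)]
  rw [key]
  refine h _ (fun l' => (hS _).add ?_)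
  split_ifs
  · exact hS _
  · exact Matrix.transpose_zero

/-- the reindexing used to present the bordered matrix on `Fin (m + (m + m))`: a weighted sum of reindexed constant
letters is the reindexed weighted sum. [folklore] -/
theorem sum_smul_map_reindex {ι : Type*} [Fintype ι] [DecidableEq ι] {N : ℕ} (e : ι ≃ Fin N)
    (w : Fin (K + 1) → ℝ[X]) (T : Fin (K + 1) → Matrix ι ι ℝ) :
    (∑ l, w l • (Matrix.reindex e e (T l)).map C) = Matrix.reindex e e (∑ l, w l • (T l).map C) := by
  refine Matrix.ext fun i j => ?_
  simp only [Matrix.sum_apply, Matrix.smul_apply, Matrix.map_apply, Matrix.reindex_apply, Matrix.submatrix_apply]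

/-- the bordered letters: entrywise identification of the pencil on `Fin m ⊕ (Fin m ⊕ Fin m)` with the three-block
bordering of the base pencil (level-`0` letter `l₀` carries the constant corner `[[0,1],[1,L]]`, the far letter is the
off-diagonal identity pair at the HALVED level `b`). [this work] -/
theorem borderThree_pencil_eq (d : Fin K → ℕ) (l₀ : Fin K) (hl₀ : d l₀ = 0) (b : ℕ)
    (S : Fin K → Matrix (Fin m) (Fin m) ℝ) (L : Matrix (Fin m) (Fin m) ℝ) :
    (∑ l, (X : ℝ[X]) ^ (Fin.snoc d b : Fin (K + 1) → ℕ) l •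
        ((Fin.snoc (α := fun _ => Matrix (Fin m ⊕ (Fin m ⊕ Fin m)) (Fin m ⊕ (Fin m ⊕ Fin m)) ℝ)
            (fun l => fromBlocks (S l) 0 0 ((if l = l₀ then (1 : ℝ) else 0) • fromBlocks 0 1 1 L))
            (fromBlocks 0 (fromCols 1 0) (fromRows 1 0) 0) l).map C)) =
      fromBlocks (∑ l, (X : ℝ[X]) ^ d l • (S l).map C)
        (fromCols ((X : ℝ[X]) ^ b • (1 : Matrix (Fin m) (Fin m) ℝ[X])) 0)
        (fromRows ((X : ℝ[X]) ^ b • (1 : Matrix (Fin m) (Fin m) ℝ[X])) 0)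
        (fromBlocks (0 : Matrix (Fin m) (Fin m) ℝ[X]) 1 1 (L.map C)) := by
  have hcorner : ∀ p q, (∑ x, C ((if x = l₀ then fromBlocks (0 : Matrix (Fin m) (Fin m) ℝ) 1 1 L else 0) p q) *
      (X : ℝ[X]) ^ d x) = C (fromBlocks (0 : Matrix (Fin m) (Fin m) ℝ) 1 1 L p q) := by
    intro p q
    rw [Finset.sum_eq_single l₀ (fun x _ hx => by rw [if_neg hx, Matrix.zero_apply, C_0, zero_mul])
      (fun h => absurd (Finset.mem_univ _) h), if_pos rfl, hl₀, pow_zero, mul_one]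
  refine Matrix.ext fun i j => ?_
  rw [Matrix.sum_apply, Fin.sum_univ_castSucc]
  simp only [Fin.snoc_castSucc, Fin.snoc_last, Matrix.smul_apply, Matrix.map_apply, smul_eq_mul]
  rcases i with i | i | i <;> rcases j with j | j | j <;>
    simp [Matrix.sum_apply, Matrix.one_apply, fromCols, fromRows, apply_ite C, hcorner]

/-- **ONE HALVING = ONE TRIPLING.**  On a support `d` containing the level `0` (at the letter `l₀`), the
`(K+1)`-letter class with far level `2b` at size `m` is bounded by the `(K+1)`-letter class with far level `b` at size
`3m`: `ζ₊(m; d, 2b) ≤ ζ₊(3m; d, b)` — by the three-block bordering identity, the far letter `X^{2b}·L` of a pencil of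
size `m` is the Schur complement of the symmetric pencil `[[G, X^b·1, 0], [X^b·1, 0, 1], [0, 1, L]]` of size `3m`, whose
letters are `Sₗ ⊕ 0` (level `dₗ`), the constant corner merged into the level-`0` letter, and the off-diagonal pair at
level `b`; the determinants agree up to the non-zero constant `det [[0,1],[1,L]]`.  Every rank and signature of `L`,
no tower hypothesis, no additive term. [this work] -/
theorem posRootLawOn_snoc_double (d : Fin K → ℕ) (l₀ : Fin K) (hl₀ : d l₀ = 0) (b : ℕ)
    (h : PosRootLawOn (m + (m + m)) (K + 1) B (Fin.snoc d b)) :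
    PosRootLawOn m (K + 1) B (Fin.snoc d (2 * b)) := by
  intro S hS
  set L : Matrix (Fin m) (Fin m) ℝ := S (Fin.last K) with hL
  set G : Matrix (Fin m) (Fin m) ℝ[X] := ∑ l, (X : ℝ[X]) ^ d l • (S (Fin.castSucc l)).map C with hG
  have hsplit : (∑ l, (X : ℝ[X]) ^ (Fin.snoc d (2 * b) : Fin (K + 1) → ℕ) l • (S l).map C) =
      G + ((X : ℝ[X]) ^ b * (X : ℝ[X]) ^ b) • L.map C := by
    rw [Fin.sum_univ_castSucc]
    simp only [Fin.snoc_castSucc, Fin.snoc_last, hG, hL, ← pow_add, two_mul]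
  -- the bordered letters and their reindexing to `Fin (m + (m + m))`
  set T : Fin (K + 1) → Matrix (Fin m ⊕ (Fin m ⊕ Fin m)) (Fin m ⊕ (Fin m ⊕ Fin m)) ℝ :=
    Fin.snoc (α := fun _ => Matrix (Fin m ⊕ (Fin m ⊕ Fin m)) (Fin m ⊕ (Fin m ⊕ Fin m)) ℝ)
      (fun l => fromBlocks (S (Fin.castSucc l)) 0 0 ((if l = l₀ then (1 : ℝ) else 0) • fromBlocks 0 1 1 L))
      (fromBlocks 0 (fromCols 1 0) (fromRows 1 0) 0) with hT
  set e : Fin m ⊕ (Fin m ⊕ Fin m) ≃ Fin (m + (m + m)) :=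
    (Equiv.sumCongr (Equiv.refl (Fin m)) finSumFinEquiv).trans finSumFinEquiv with he
  have hTsymm : ∀ l, (T l).IsSymm := by
    intro l
    refine Fin.lastCases ?_ (fun l => ?_) l
    · simp only [hT, Fin.snoc_last]
      rw [Matrix.IsSymm, fromBlocks_transpose, transpose_zero, transpose_zero, transpose_fromCols,
        transpose_fromRows, transpose_one, transpose_zero]
    · simp only [hT, Fin.snoc_castSucc]
      rw [Matrix.IsSymm, fromBlocks_transpose, transpose_zero, transpose_zero, (hS _).eq, transpose_smul,
        fromBlocks_transpose, transpose_zero, transpose_one, (hS _).eq]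
  have hB := h (fun l => Matrix.reindex e e (T l)) (fun l => (hTsymm l).submatrix _)
  have hpencil := borderThree_pencil_eq (m := m) d l₀ hl₀ b (fun l => S (Fin.castSucc l)) L
  -- determinant bookkeeping
  have hdetN : (fromBlocks (0 : Matrix (Fin m) (Fin m) ℝ) 1 1 L).det ≠ 0 :=
    left_ne_zero_of_mul_eq_one (det_borderThree_mul L)
  have hNmap : (fromBlocks (0 : Matrix (Fin m) (Fin m) ℝ) 1 1 L).map C =
      fromBlocks (0 : Matrix (Fin m) (Fin m) ℝ[X]) 1 1 (L.map C) := by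
    rw [fromBlocks_map, Matrix.map_one C C_0 C_1, Matrix.map_zero C C_0]
  have hdetN' : (fromBlocks (0 : Matrix (Fin m) (Fin m) ℝ[X]) 1 1 (L.map C)).det =
      C (fromBlocks (0 : Matrix (Fin m) (Fin m) ℝ) 1 1 L).det := by
    rw [← hNmap, RingHom.map_det, RingHom.mapMatrix_apply]
  have hdet : (∑ l, (X : ℝ[X]) ^ (Fin.snoc d b : Fin (K + 1) → ℕ) l • (Matrix.reindex e e (T l)).map C).det =
      C (fromBlocks (0 : Matrix (Fin m) (Fin m) ℝ) 1 1 L).det * (G + ((X : ℝ[X]) ^ b * (X : ℝ[X]) ^ b) • L.map C).det := by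
    rw [sum_smul_map_reindex, Matrix.det_reindex_self, hT, hpencil, det_borderThree_eq, hdetN', hG]
  have hroots : (∑ l, (X : ℝ[X]) ^ (Fin.snoc d (2 * b) : Fin (K + 1) → ℕ) l • (S l).map C).det.roots =
      (∑ l, (X : ℝ[X]) ^ (Fin.snoc d b : Fin (K + 1) → ℕ) l • (Matrix.reindex e e (T l)).map C).det.roots := by
    rw [hdet, Polynomial.roots_C_mul _ hdetN, hsplit]
  rw [hroots]
  exact hB

/-- **`n` HALVINGS — A DYADIC FAR LETTER IS ABSORBED BY THE `K`-LETTER CLASS AT SIZE `3ⁿ·m`.**  On a support `d`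
containing the level `0` (letter `l₀`), for every letter index `l` and every `n`,
`PosRootLawOn (3ⁿ·m) K B d → PosRootLawOn m (K+1) B (d, 2ⁿ·d l)`, i.e. `ζ₊(m; d, 2ⁿ·dₗ) ≤ ζ₊(3ⁿ·m; d)`: `n` halvings
bring the far level `2ⁿ·dₗ` down to the existing level `dₗ`, where the far letter merges into the letter `l`
(`posRootLawOn_snoc_self`); each halving triples the size (`posRootLawOn_snoc_double`).  An exact EXCHANGE between the
LETTER axis (one more letter, S5 `TowerGraftLaw`) and the SIZE axis (same support, bigger matrices, S4d `TowerSizeDoubling`)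
of the line `Cruxes/WeakLifting/Lines/tower_graft.lean`; no tower hypothesis, no additive term, every `B`. [this work] -/
theorem posRootLawOn_snoc_dyadic (d : Fin K → ℕ) (l₀ : Fin K) (hl₀ : d l₀ = 0) (l : Fin K) (n : ℕ) :
    ∀ {m : ℕ}, PosRootLawOn (3 ^ n * m) K B d → PosRootLawOn m (K + 1) B (Fin.snoc d (2 ^ n * d l)) := by
  induction n with
  | zero =>
    intro m h
    rw [pow_zero, one_mul] at h ⊢
    exact posRootLawOn_snoc_self d l h
  | succ n ih =>
    intro m h
    have h3 : PosRootLawOn (3 ^ n * (m + (m + m))) K B d := by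
      have e3 : 3 ^ (n + 1) * m = 3 ^ n * (m + (m + m)) := by ring
      rw [e3] at h
      exact h
    have e2 : 2 ^ (n + 1) * d l = 2 * (2 ^ n * d l) := by ring
    rw [e2]
    exact posRootLawOn_snoc_double d l₀ hl₀ (2 ^ n * d l) (ih h3)

/-- contrapositive, for the census's lower-bound table: a `(K+1)`-letter pencil of size `m` on `(d, 2ⁿ·dₗ)` with more
than `B` positive roots yields a `K`-letter pencil of size `3ⁿ·m` on `d` with more than `B` positive roots. [this work] -/
theorem not_posRootLawOn_of_snoc_dyadic (d : Fin K → ℕ) (l₀ : Fin K) (hl₀ : d l₀ = 0) (l : Fin K) (n : ℕ)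
    (h : ¬ PosRootLawOn m (K + 1) B (Fin.snoc d (2 ^ n * d l))) : ¬ PosRootLawOn (3 ^ n * m) K B d :=
  fun h' => h (posRootLawOn_snoc_dyadic d l₀ hl₀ l n h')

open Summit.ValiantsHypothesis.ValiantsHypothesis.Theorems.LacunarySymmetroidMatrixDescartes.Census in
/-- the same on a support with arbitrary minimum level `d l₀` (translation of all exponents keeps the positive roots,
`Census.posRootLawOn_add_const_iff`): far level `d l₀ + 2ⁿ·(d l − d l₀)`.  For a tower `0 = d₀ < d₁ < ⋯` this is the
previous statement. [this work] -/
theorem posRootLawOn_snoc_dyadic_shift (d : Fin K → ℕ) (l₀ : Fin K) (hmin : ∀ l', d l₀ ≤ d l') (l : Fin K) (n : ℕ)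
    (h : PosRootLawOn (3 ^ n * m) K B d) :
    PosRootLawOn m (K + 1) B (Fin.snoc d (d l₀ + 2 ^ n * (d l - d l₀))) := by
  set d' : Fin K → ℕ := fun l' => d l' - d l₀ with hd'
  have hd : d = fun l' => d' l' + d l₀ := funext fun l' => (Nat.sub_add_cancel (hmin l')).symm
  have h' : PosRootLawOn (3 ^ n * m) K B d' := by
    rw [← posRootLawOn_add_const_iff d' (d l₀), ← hd]
    exact h
  have key := posRootLawOn_snoc_dyadic (B := B) d' l₀ (by simp [hd']) l n h'
  have hsnoc : (Fin.snoc d (d l₀ + 2 ^ n * (d l - d l₀)) : Fin (K + 1) → ℕ) =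
      fun l' => (Fin.snoc d' (2 ^ n * d' l) : Fin (K + 1) → ℕ) l' + d l₀ := by
    funext l'
    refine Fin.lastCases ?_ (fun l' => ?_) l'
    · simp only [Fin.snoc_last, hd']
      ring
    · simp only [Fin.snoc_castSucc, hd']
      exact (Nat.sub_add_cancel (hmin l')).symm
  rw [hsnoc, posRootLawOn_add_const_iff]
  exact key

end Halving

end Summit.ValiantsHypothesis.ValiantsHypothesis.Theorems.KPlusLogSqLaw.TowerGraft
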